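import Summits.ResolutionOfSingularities.ResolutionOfSingularities.Theorems.EquisingularLiftEquisingularLiftNatSpecimenCayleyRuledAlgebra
import HarnessLib

/-!
# [OURS · L1 W4.5(b) · EL♮(3)] (K-ν-3) THE STEINER TEST at ring level — Steiner's Roman surface `x²y² + y²z² + z²x² + xyzw`: the point step at the triple point and
# the blow-up of the three disjoint double lines one floor up RESOLVE it (polynomial identities + regularity of every strict-transform chart, every characteristic)

Cell `res-hironaka`, slot W4.5(b); crux **EL♮(3)** (stmt-ResolutionOfSingularities-20148); width seat res-L1-w45b-nose-w3 — desk R36′ deal «(K-ν-3) Steiner = the first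
post-(N0) nose certificate → nose-w3» (NOSE WORD v1.1 §4, res-L1-w45b-nose-w2). `--supports stmt-ResolutionOfSingularities-20148 --as helper`; closes nothing. OURS; NOT a
statement of any manuscript; AI-written, weaker than expert review. Seven small `def`s (chart equations), no `sorry`, standard axioms, no local instances.
By-hand verdict of record: `L/res-L1-w45b-nose-w3/STEINER-TEST.md` 96168862e531bf6f («Steiner ∈ ν2»: one point step, nose = three disjoint lines with trivial normal bundle,
ONE blow-up, EMPTY B‴ round phase). THIS FILE = the ring-level kernel content of that verdict; the scheme-level assembly over (N0) `ReachPtNoseBTriplePrime` /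
`NoseHypPointsFirstBTriplePrime` (abstract `Bl_P ℙ³`, `DirStepUnobs` by the Čech kit, two-level chart transport) is the (N0)/(N4) owners' and stays OPEN (honest size L–XL).

`S = V₊(F) ⊂ ℙ³_k`, `F = x₀²x₁² + x₁²x₂² + x₂²x₀² + x₀x₁x₂x₃` (Steiner's Roman surface; `w = x₃`), triple point `P = [0:0:0:1]`, double lines = the coordinate axes through `P`.
* `prime_form` — `F` is prime (degree one in `x₃`, coefficient `x₀x₁x₂` relatively prime to `x₀²x₁² + x₁²x₂² + x₂²x₀²`);
* `f` = `F(x₃ := 1)` = `y₀²y₁² + y₁²y₂² + y₂²y₀² + y₀y₁y₂`, `f_mem_sq` (`f ∈ 𝔪_P²`: `P` is NOT a regular point — the point step is E1-legal);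
* THE POINT STEP: `subst_point_f` — Hu's substitution at the origin of `𝔸³` (all three variables, chart `y₀`): `f ↦ y₀³ · f₁`, `f₁ = y₀(y₁² + y₁²y₂² + y₂²) + y₁y₂`
  (`X 0 ∤ f₁`); by the 𝔖₃-symmetry of `f` this is the only chart up to renaming; the strict transform of the double line `y₁ = y₂ = 0` is the line `y₁ = y₂ = 0` of the chart;
* THE NOSE ONE FLOOR UP, near `E`: `isRegularRing_chart₁/₂` — the two strict-transform charts of `V(f₁)` along `(y₁, y₂)` are REGULAR: `f₁′ = y₀(1 + y₂² + y₁²y₂²) + y₂` by the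
  COMBINATION derivation `∂₂ + 2y₀²(1 + y₁²)·∂₀` (`↦ 1 + 2y₀(1+y₁²)·f₁′ ≡ 1`; no single partial is a unit), and its mirror under `y₁ ↔ y₂`;
* THE NOSE AWAY FROM `E` (chart `x₀ = 1` of `ℙ³`, coordinates ordered `(w, y, z)` so that the double line is `(y₁, y₂)`): `g = y₁² + y₁²y₂² + y₂² + y₀y₁y₂`,
  `isRegularRing_chartFar₁/₂` — both strict-transform charts regular (`g′ = 1 + y₂² + y₁²y₂² + y₀y₂`, `∂₀ = y₂` a unit) — these charts CONTAIN the pinch points `w = ±2`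
  (Whitney umbrellas are resolved by the blow-up of their double line);
* `prime_f₁`, `prime_g`, radical ideals (the chart rings of the assembler are the quotients by these).
Everything holds over every field (characteristic 2 included: the combination derivation degenerates to `∂₂` and still gives `1`).
-/

set_option linter.dupNamespace false -- mandated namespace `Summit.<Summit>.<Problem>` of this single-conjunct summit

noncomputable section

open MvPolynomial
open Literature.AlgebraicGeometry.Resolution

namespace Summit.ResolutionOfSingularities.ResolutionOfSingularities.Cruxes.EquisingularLiftNat.Sections

namespace Steiner

variable (k : Type) [Field k]

/-! ## The form and its primality -/

/-- **Steiner's Roman surface** `F = x₀²x₁² + x₁²x₂² + x₂²x₀² + x₀x₁x₂x₃ ∈ k[x₀, …, x₃]`. [folklore] -/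
def form : MvPolynomial (Fin 4) k := X 0 ^ 2 * X 1 ^ 2 + X 1 ^ 2 * X 2 ^ 2 + X 2 ^ 2 * X 0 ^ 2 + X 0 * X 1 * X 2 * X 3

/-- `x₀x₁x₂` and `x₀²x₁² + x₁²x₂² + x₂²x₀²` (in `k[z₀, z₁, z₂]`) are relatively prime: no variable divides the second. [folklore] -/
theorem isRelPrime_coeff₄ :
    IsRelPrime (X 0 * X 1 * X 2 : MvPolynomial (Fin 3) k) (X 0 ^ 2 * X 1 ^ 2 + X 1 ^ 2 * X 2 ^ 2 + X 2 ^ 2 * X 0 ^ 2) := by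
  have hp : ∀ i : Fin 3, Prime (X i : MvPolynomial (Fin 3) k) := fun i => X_prime
  have hnd : ∀ (i a b : Fin 3), i ≠ a → i ≠ b →
      (X i : MvPolynomial (Fin 3) k) ∣ X i ^ 2 * X a ^ 2 + X a ^ 2 * X b ^ 2 + X b ^ 2 * X i ^ 2 → False := by
    intro i a b hia hib h
    have h1 : (X i : MvPolynomial (Fin 3) k) ∣ X i ^ 2 * X a ^ 2 := Dvd.dvd.mul_right (dvd_pow_self (X i) two_ne_zero) _
    have h2 : (X i : MvPolynomial (Fin 3) k) ∣ X b ^ 2 * X i ^ 2 := Dvd.dvd.mul_left (dvd_pow_self (X i) two_ne_zero) _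
    have h' : (X i : MvPolynomial (Fin 3) k) ∣ X a ^ 2 * X b ^ 2 := (dvd_add_right h1).mp ((dvd_add_left h2).mp h)
    rcases (hp i).dvd_or_dvd h' with ha | hb
    · exact hia (X_dvd_X.mp ((hp i).dvd_of_dvd_pow ha))
    · exact hib (X_dvd_X.mp ((hp i).dvd_of_dvd_pow hb))
  have e0 : (X 0 ^ 2 * X 1 ^ 2 + X 1 ^ 2 * X 2 ^ 2 + X 2 ^ 2 * X 0 ^ 2 : MvPolynomial (Fin 3) k) =
      X 0 ^ 2 * X 1 ^ 2 + X 1 ^ 2 * X 2 ^ 2 + X 2 ^ 2 * X 0 ^ 2 := rfl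
  have e1 : (X 0 ^ 2 * X 1 ^ 2 + X 1 ^ 2 * X 2 ^ 2 + X 2 ^ 2 * X 0 ^ 2 : MvPolynomial (Fin 3) k) =
      X 1 ^ 2 * X 2 ^ 2 + X 2 ^ 2 * X 0 ^ 2 + X 0 ^ 2 * X 1 ^ 2 := by ring
  have e2 : (X 0 ^ 2 * X 1 ^ 2 + X 1 ^ 2 * X 2 ^ 2 + X 2 ^ 2 * X 0 ^ 2 : MvPolynomial (Fin 3) k) =
      X 2 ^ 2 * X 0 ^ 2 + X 0 ^ 2 * X 1 ^ 2 + X 1 ^ 2 * X 2 ^ 2 := by ring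
  refine ((CayleyRuled.isRelPrime_of_prime_of_not_dvd (hp 0) ?_).mul_left
    (CayleyRuled.isRelPrime_of_prime_of_not_dvd (hp 1) ?_)).mul_left (CayleyRuled.isRelPrime_of_prime_of_not_dvd (hp 2) ?_)
  · intro h; exact hnd 0 1 2 (by decide) (by decide) (e0 ▸ h)
  · intro h; rw [e1] at h; exact hnd 1 2 0 (by decide) (by decide) h
  · intro h; rw [e2] at h; exact hnd 2 0 1 (by decide) (by decide) h

/-- **`F` is prime**: after `x₀ ↔ x₃` it is `C(z₀z₁z₂)·Y + C(z₀²z₁² + z₁²z₂² + z₂²z₀²)` over `k[z₀, z₁, z₂]`, degree one with relatively prime coefficients. [folklore] -/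
theorem prime_form : Prime (Steiner.form k) := by
  have hfin : finSuccEquiv k 3 (rename (Equiv.swap (0 : Fin 4) 3) (Steiner.form k)) =
      Polynomial.C (X 0 * X 1 * X 2) * Polynomial.X + Polynomial.C (X 0 ^ 2 * X 1 ^ 2 + X 1 ^ 2 * X 2 ^ 2 + X 2 ^ 2 * X 0 ^ 2) := by
    have h1 : finSuccEquiv k 3 (X 1) = Polynomial.C (X 0) := finSuccEquiv_X_succ (j := 0)
    have h2 : finSuccEquiv k 3 (X 2) = Polynomial.C (X 1) := finSuccEquiv_X_succ (j := 1)
    have h3 : finSuccEquiv k 3 (X 3) = Polynomial.C (X 2) := finSuccEquiv_X_succ (j := 2)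
    simp only [Steiner.form, map_add, map_mul, map_pow, rename_X, Equiv.swap_apply_left, Equiv.swap_apply_right,
      Equiv.swap_apply_of_ne_of_ne (show (1 : Fin 4) ≠ 0 by decide) (show (1 : Fin 4) ≠ 3 by decide),
      Equiv.swap_apply_of_ne_of_ne (show (2 : Fin 4) ≠ 0 by decide) (show (2 : Fin 4) ≠ 3 by decide),
      finSuccEquiv_X_zero, h1, h2, h3]
    ring
  have hirr : Irreducible (rename (Equiv.swap (0 : Fin 4) 3) (Steiner.form k)) := by
    rw [← MulEquiv.irreducible_iff (finSuccEquiv k 3), hfin]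
    exact Polynomial.irreducible_C_mul_X_add_C (mul_ne_zero (mul_ne_zero (X_ne_zero 0) (X_ne_zero 1)) (X_ne_zero 2))
      (isRelPrime_coeff₄ k)
  have hirr' : Irreducible (Steiner.form k) :=
    (MulEquiv.irreducible_iff (renameEquiv k (Equiv.swap (0 : Fin 4) 3)).toMulEquiv (x := Steiner.form k)).mp hirr
  exact UniqueFactorizationMonoid.irreducible_iff_prime.mp hirr'

/-! ## The chart of the triple point and the point step -/

/-- `f = F(x₃ := 1) = y₀²y₁² + y₁²y₂² + y₂²y₀² + y₀y₁y₂`: the chart `D₊(x₃)` containing the triple point `P` = origin. [folklore] -/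
def f : MvPolynomial (Fin 3) k := X 0 ^ 2 * X 1 ^ 2 + X 1 ^ 2 * X 2 ^ 2 + X 2 ^ 2 * X 0 ^ 2 + X 0 * X 1 * X 2

/-- **`f ∈ 𝔪_P²`** (indeed `∈ 𝔪_P³`): the origin is NOT a regular point of `V(f)` (Matsumura 14.2 at assembly, tree
`not_isRegularLocalRing_quotient_span_singleton_of_mem_sq'`) — the point step at `P` is E1-legal. [folklore] -/
theorem f_mem_sq : f k ∈ (Ideal.span {(X 0 : MvPolynomial (Fin 3) k), X 1, X 2}) ^ 2 := by
  have h0 : (X 0 : MvPolynomial (Fin 3) k) ∈ Ideal.span {(X 0 : MvPolynomial (Fin 3) k), X 1, X 2} := Ideal.subset_span (by simp)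
  have h1 : (X 1 : MvPolynomial (Fin 3) k) ∈ Ideal.span {(X 0 : MvPolynomial (Fin 3) k), X 1, X 2} := Ideal.subset_span (by simp)
  have h2 : (X 2 : MvPolynomial (Fin 3) k) ∈ Ideal.span {(X 0 : MvPolynomial (Fin 3) k), X 1, X 2} := Ideal.subset_span (by simp)
  have e : f k = (X 0 * X 1) * (X 0 * X 1) + (X 1 * X 2) * (X 1 * X 2) + (X 2 * X 0) * (X 2 * X 0) + X 0 * (X 1 * X 2) := by rw [f]; ring
  rw [e, pow_two]
  refine Ideal.add_mem _ (Ideal.add_mem _ (Ideal.add_mem _ ?_ ?_) ?_) ?_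
  · exact Ideal.mul_mem_mul (Ideal.mul_mem_left _ _ h1) (Ideal.mul_mem_left _ _ h1)
  · exact Ideal.mul_mem_mul (Ideal.mul_mem_left _ _ h2) (Ideal.mul_mem_left _ _ h2)
  · exact Ideal.mul_mem_mul (Ideal.mul_mem_left _ _ h0) (Ideal.mul_mem_left _ _ h0)
  · exact Ideal.mul_mem_mul h0 (Ideal.mul_mem_left _ _ h2)

/-- `f₁ = y₀(y₁² + y₁²y₂² + y₂²) + y₁y₂`: the strict transform of `f` on the chart `y₀` of the blow-up of the origin; its double line is `y₁ = y₂ = 0`. [folklore] -/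
def f₁ : MvPolynomial (Fin 3) k := X 0 * (X 1 ^ 2 + X 1 ^ 2 * X 2 ^ 2 + X 2 ^ 2) + X 1 * X 2

/-- **THE POINT STEP** (Hu's substitution at the origin, all three variables, chart `y₀`: `y₁ ↦ y₀y₁`, `y₂ ↦ y₀y₂`): `f ↦ y₀³ · f₁`. [folklore] -/
theorem subst_point_f : coordBlowupSubst k (Set.univ : Set (Fin 3)) 0 (f k) = X 0 ^ 3 * f₁ k := by
  have h0 : coordBlowupSubst k (Set.univ : Set (Fin 3)) 0 (X 0 : MvPolynomial (Fin 3) k) = X 0 := coordBlowupSubst_X_self k _ 0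
  have h1 : coordBlowupSubst k (Set.univ : Set (Fin 3)) 0 (X 1 : MvPolynomial (Fin 3) k) = X 0 * X 1 :=
    coordBlowupSubst_X_of_mem_of_ne k _ 0 (Set.mem_univ _) (by decide)
  have h2 : coordBlowupSubst k (Set.univ : Set (Fin 3)) 0 (X 2 : MvPolynomial (Fin 3) k) = X 0 * X 2 :=
    coordBlowupSubst_X_of_mem_of_ne k _ 0 (Set.mem_univ _) (by decide)
  simp only [f, f₁, map_add, map_mul, map_pow, h0, h1, h2]
  ring

/-- `y₀ ∤ f₁` (the strict transform is the saturation: evaluate at `(0, 1, 1)`). [folklore] -/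
theorem X_zero_not_dvd_f₁ : ¬ ((X 0 : MvPolynomial (Fin 3) k) ∣ f₁ k) := by
  rintro ⟨q, hq⟩
  have h := congrArg (MvPolynomial.eval ![(0 : k), 1, 1]) hq
  simp [f₁] at h

/-! ## The nose one floor up, near the exceptional plane: the two strict-transform charts of `V(f₁)` along `(y₁, y₂)` -/

/-- `f₁′ = y₀(1 + y₂² + y₁²y₂²) + y₂`: chart `b = y₁`. [folklore] -/
def f₁' : MvPolynomial (Fin 3) k := X 0 * (1 + X 2 ^ 2 + X 1 ^ 2 * X 2 ^ 2) + X 2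

/-- `f₁″ = y₀(1 + y₁² + y₁²y₂²) + y₁`: chart `b = y₂`. [folklore] -/
def f₁'' : MvPolynomial (Fin 3) k := X 0 * (1 + X 1 ^ 2 + X 1 ^ 2 * X 2 ^ 2) + X 1

/-- **Chart `b = y₁`** (`y₂ ↦ y₁y₂`): `f₁ ↦ y₁²·f₁′`, and `V(f₁′)` is regular by the COMBINATION derivation `D = ∂₂ + 2y₀²(1+y₁²)·∂₀`: `D f₁′ = 1 + 2y₀(1+y₁²)·f₁′ ≡ 1 (mod f₁′)`.
[folklore] -/
theorem isRegularRing_chart₁ :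
    IsRegularRing (blowupAlgebra ((Ideal.span (X '' CuspCone.cenVars)).map (Ideal.Quotient.mk (Ideal.span {f₁ k})))
      (Ideal.Quotient.mk (Ideal.span {f₁ k}) (X 1 : MvPolynomial (Fin 3) k))) := by
  obtain ⟨h0, h1, h2⟩ := CuspCone.subst₁_X k
  refine CuspCone.isRegularRing_strictTransformChart k (f₁ k) (f₁' k) 1 2 ?_ ?_ ?_
  · simp only [f₁, f₁', map_add, map_mul, map_pow, h0, h1, h2]
    ring
  · rintro ⟨q, hq⟩
    have h := congrArg (MvPolynomial.eval ![(0 : k), 0, 1]) hq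
    simp [f₁'] at h
  · refine isRegularRing_quotient_of_derivation (f₁' k)
      (pderiv 2 + (2 * X 0 ^ 2 * (1 + X 1 ^ 2) : MvPolynomial (Fin 3) k) • pderiv 0 :
        Derivation k (MvPolynomial (Fin 3) k) (MvPolynomial (Fin 3) k)) ?_
    have hD : (pderiv 2 + (2 * X 0 ^ 2 * (1 + X 1 ^ 2) : MvPolynomial (Fin 3) k) • pderiv 0 :
        Derivation k (MvPolynomial (Fin 3) k) (MvPolynomial (Fin 3) k)) (f₁' k) = 1 + 2 * X 0 * (1 + X 1 ^ 2) * f₁' k := by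
      simp [f₁', Derivation.leibniz_pow, pderiv_X]
      ring
    have hq : Ideal.Quotient.mk (Ideal.span {f₁' k}) ((pderiv 2 + (2 * X 0 ^ 2 * (1 + X 1 ^ 2) : MvPolynomial (Fin 3) k) • pderiv 0 :
        Derivation k (MvPolynomial (Fin 3) k) (MvPolynomial (Fin 3) k)) (f₁' k)) = 1 := by
      rw [hD, ← (Ideal.Quotient.mk _).map_one, Ideal.Quotient.eq]
      exact Ideal.mem_span_singleton.mpr ⟨2 * X 0 * (1 + X 1 ^ 2), by ring⟩
    rw [hq]
    exact isUnit_one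

/-- **Chart `b = y₂`** (`y₁ ↦ y₂y₁`): the mirror image under `y₁ ↔ y₂`, `D = ∂₁ + 2y₀²(1+y₂²)·∂₀`. [folklore] -/
theorem isRegularRing_chart₂ :
    IsRegularRing (blowupAlgebra ((Ideal.span (X '' CuspCone.cenVars)).map (Ideal.Quotient.mk (Ideal.span {f₁ k})))
      (Ideal.Quotient.mk (Ideal.span {f₁ k}) (X 2 : MvPolynomial (Fin 3) k))) := by
  obtain ⟨h0, h1, h2⟩ := CuspCone.subst₂_X k
  refine CuspCone.isRegularRing_strictTransformChart k (f₁ k) (f₁'' k) 2 2 ?_ ?_ ?_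
  · simp only [f₁, f₁'', map_add, map_mul, map_pow, h0, h1, h2]
    ring
  · rintro ⟨q, hq⟩
    have h := congrArg (MvPolynomial.eval ![(0 : k), 1, 0]) hq
    simp [f₁''] at h
  · refine isRegularRing_quotient_of_derivation (f₁'' k)
      (pderiv 1 + (2 * X 0 ^ 2 * (1 + X 2 ^ 2) : MvPolynomial (Fin 3) k) • pderiv 0 :
        Derivation k (MvPolynomial (Fin 3) k) (MvPolynomial (Fin 3) k)) ?_
    have hD : (pderiv 1 + (2 * X 0 ^ 2 * (1 + X 2 ^ 2) : MvPolynomial (Fin 3) k) • pderiv 0 :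
        Derivation k (MvPolynomial (Fin 3) k) (MvPolynomial (Fin 3) k)) (f₁'' k) = 1 + 2 * X 0 * (1 + X 2 ^ 2) * f₁'' k := by
      simp [f₁'', Derivation.leibniz_pow, pderiv_X]
      ring
    have hq : Ideal.Quotient.mk (Ideal.span {f₁'' k}) ((pderiv 1 + (2 * X 0 ^ 2 * (1 + X 2 ^ 2) : MvPolynomial (Fin 3) k) • pderiv 0 :
        Derivation k (MvPolynomial (Fin 3) k) (MvPolynomial (Fin 3) k)) (f₁'' k)) = 1 := by
      rw [hD, ← (Ideal.Quotient.mk _).map_one, Ideal.Quotient.eq]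
      exact Ideal.mem_span_singleton.mpr ⟨2 * X 0 * (1 + X 2 ^ 2), by ring⟩
    rw [hq]
    exact isUnit_one

/-! ## The nose away from the exceptional plane: chart `x₀ = 1` of `ℙ³` in the variable order `(w, y, z)` -/

/-- `g = y₁² + y₁²y₂² + y₂² + y₀y₁y₂` = `F(x₀ := 1)` with `(y₀, y₁, y₂) = (x₃, x₁, x₂)` (so that the double line is `(y₁, y₂)`); the pinch points are `y₀ = ±2`.
[folklore] -/
def g : MvPolynomial (Fin 3) k := X 1 ^ 2 + X 1 ^ 2 * X 2 ^ 2 + X 2 ^ 2 + X 0 * X 1 * X 2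

/-- `g′ = 1 + y₂² + y₁²y₂² + y₀y₂`: chart `b = y₁`. [folklore] -/
def g' : MvPolynomial (Fin 3) k := 1 + X 2 ^ 2 + X 1 ^ 2 * X 2 ^ 2 + X 0 * X 2

/-- `g″ = 1 + y₁² + y₁²y₂² + y₀y₁`: chart `b = y₂`. [folklore] -/
def g'' : MvPolynomial (Fin 3) k := 1 + X 1 ^ 2 + X 1 ^ 2 * X 2 ^ 2 + X 0 * X 1

/-- **Far chart `b = y₁`**: `g ↦ y₁²·g′`; `∂₀ g′ = y₂` is a unit modulo `g′` (`y₂·(−y₀ − y₂ − y₁²y₂) = 1 − g′`) — the chart through the PINCH POINTS. [folklore] -/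
theorem isRegularRing_chartFar₁ :
    IsRegularRing (blowupAlgebra ((Ideal.span (X '' CuspCone.cenVars)).map (Ideal.Quotient.mk (Ideal.span {g k})))
      (Ideal.Quotient.mk (Ideal.span {g k}) (X 1 : MvPolynomial (Fin 3) k))) := by
  obtain ⟨h0, h1, h2⟩ := CuspCone.subst₁_X k
  refine CuspCone.isRegularRing_strictTransformChart k (g k) (g' k) 1 2 ?_ ?_ ?_
  · simp only [g, g', map_add, map_mul, map_pow, h0, h1, h2]
    ring
  · rintro ⟨q, hq⟩
    have h := congrArg (MvPolynomial.eval ![(0 : k), 0, 0]) hq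
    simp [g'] at h
  · refine isRegularRing_quotient_of_derivation (g' k) (pderiv 0 : Derivation k (MvPolynomial (Fin 3) k) (MvPolynomial (Fin 3) k)) ?_
    have h : (pderiv 0 : Derivation k (MvPolynomial (Fin 3) k) (MvPolynomial (Fin 3) k)) (g' k) = X 2 := by
      simp [g', pderiv_X, Derivation.leibniz_pow]
    rw [h]
    refine WhitneyCubic.isUnit_of_mul_eq_one' (Ideal.Quotient.mk _ (-(X 0) - X 2 - X 1 ^ 2 * X 2)) ?_
    rw [← map_mul, ← (Ideal.Quotient.mk _).map_one, Ideal.Quotient.eq]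
    exact Ideal.mem_span_singleton.mpr ⟨-1, by rw [g']; ring⟩

/-- **Far chart `b = y₂`**: the mirror image, `∂₀ g″ = y₁` a unit. [folklore] -/
theorem isRegularRing_chartFar₂ :
    IsRegularRing (blowupAlgebra ((Ideal.span (X '' CuspCone.cenVars)).map (Ideal.Quotient.mk (Ideal.span {g k})))
      (Ideal.Quotient.mk (Ideal.span {g k}) (X 2 : MvPolynomial (Fin 3) k))) := by
  obtain ⟨h0, h1, h2⟩ := CuspCone.subst₂_X k
  refine CuspCone.isRegularRing_strictTransformChart k (g k) (g'' k) 2 2 ?_ ?_ ?_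
  · simp only [g, g'', map_add, map_mul, map_pow, h0, h1, h2]
    ring
  · rintro ⟨q, hq⟩
    have h := congrArg (MvPolynomial.eval ![(0 : k), 0, 0]) hq
    simp [g''] at h
  · refine isRegularRing_quotient_of_derivation (g'' k) (pderiv 0 : Derivation k (MvPolynomial (Fin 3) k) (MvPolynomial (Fin 3) k)) ?_
    have h : (pderiv 0 : Derivation k (MvPolynomial (Fin 3) k) (MvPolynomial (Fin 3) k)) (g'' k) = X 1 := by
      simp [g'', pderiv_X, Derivation.leibniz_pow]
    rw [h]
    refine WhitneyCubic.isUnit_of_mul_eq_one' (Ideal.Quotient.mk _ (-(X 0) - X 1 - X 1 * X 2 ^ 2)) ?_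
    rw [← map_mul, ← (Ideal.Quotient.mk _).map_one, Ideal.Quotient.eq]
    exact Ideal.mem_span_singleton.mpr ⟨-1, by rw [g'']; ring⟩

/-! ## The chart equations `f₁`, `g` are prime -/

/-- `z₀z₁` and `z₀² + z₀²z₁² + z₁²` (in `k[z₀, z₁]`) are relatively prime (`z₀ ∤ z₁²`, `z₁ ∤ z₀²`). [folklore] -/
theorem isRelPrime_coeff : IsRelPrime (X 0 * X 1 : MvPolynomial (Fin 2) k) (X 0 ^ 2 + X 0 ^ 2 * X 1 ^ 2 + X 1 ^ 2) := by
  have hp0 : Prime (X 0 : MvPolynomial (Fin 2) k) := X_prime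
  have hp1 : Prime (X 1 : MvPolynomial (Fin 2) k) := X_prime
  have h0 : ¬ ((X 0 : MvPolynomial (Fin 2) k) ∣ X 0 ^ 2 + X 0 ^ 2 * X 1 ^ 2 + X 1 ^ 2) := by
    intro h
    have hd : (X 0 : MvPolynomial (Fin 2) k) ∣ X 0 ^ 2 + X 0 ^ 2 * X 1 ^ 2 :=
      dvd_add (dvd_pow_self (X 0) two_ne_zero) (Dvd.dvd.mul_right (dvd_pow_self (X 0) two_ne_zero) _)
    have h' : (X 0 : MvPolynomial (Fin 2) k) ∣ X 1 ^ 2 := (dvd_add_right hd).mp h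
    exact absurd (X_dvd_X.mp (hp0.dvd_of_dvd_pow h')) (by decide)
  have h1 : ¬ ((X 1 : MvPolynomial (Fin 2) k) ∣ X 0 ^ 2 + X 0 ^ 2 * X 1 ^ 2 + X 1 ^ 2) := by
    intro h
    have e : (X 0 ^ 2 + X 0 ^ 2 * X 1 ^ 2 + X 1 ^ 2 : MvPolynomial (Fin 2) k) = (X 0 ^ 2 * X 1 ^ 2 + X 1 ^ 2) + X 0 ^ 2 := by ring
    rw [e] at h
    have hd : (X 1 : MvPolynomial (Fin 2) k) ∣ X 0 ^ 2 * X 1 ^ 2 + X 1 ^ 2 :=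
      dvd_add (Dvd.dvd.mul_left (dvd_pow_self (X 1) two_ne_zero) _) (dvd_pow_self (X 1) two_ne_zero)
    have h' : (X 1 : MvPolynomial (Fin 2) k) ∣ X 0 ^ 2 := (dvd_add_right hd).mp h
    exact absurd (X_dvd_X.mp (hp1.dvd_of_dvd_pow h')) (by decide)
  exact (CayleyRuled.isRelPrime_of_prime_of_not_dvd hp0 h0).mul_left (CayleyRuled.isRelPrime_of_prime_of_not_dvd hp1 h1)

/-- **`f₁` is prime** (degree one in `y₀`: `C(z₀² + z₀²z₁² + z₁²)·Y + C(z₀z₁)`, relatively prime coefficients). [folklore] -/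
theorem prime_f₁ : Prime (f₁ k) := by
  have hfin : finSuccEquiv k 2 (f₁ k) = Polynomial.C (X 0 ^ 2 + X 0 ^ 2 * X 1 ^ 2 + X 1 ^ 2) * Polynomial.X + Polynomial.C (X 0 * X 1) := by
    have h1 : finSuccEquiv k 2 (X 1) = Polynomial.C (X 0) := finSuccEquiv_X_succ (j := 0)
    have h2 : finSuccEquiv k 2 (X 2) = Polynomial.C (X 1) := finSuccEquiv_X_succ (j := 1)
    simp only [f₁, map_add, map_mul, map_pow, finSuccEquiv_X_zero, h1, h2]
    ring
  have hne : (X 0 ^ 2 + X 0 ^ 2 * X 1 ^ 2 + X 1 ^ 2 : MvPolynomial (Fin 2) k) ≠ 0 := by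
    intro h
    have h' := congrArg (MvPolynomial.eval ![(1 : k), 0]) h
    simp at h'
  have hirr : Irreducible (f₁ k) := by
    rw [← MulEquiv.irreducible_iff (finSuccEquiv k 2), hfin]
    exact Polynomial.irreducible_C_mul_X_add_C hne (isRelPrime_coeff k).symm
  exact UniqueFactorizationMonoid.irreducible_iff_prime.mp hirr

/-- **`g` is prime** (degree one in `y₀`: `C(z₀z₁)·Y + C(z₀² + z₀²z₁² + z₁²)`). [folklore] -/
theorem prime_g : Prime (g k) := by
  have hfin : finSuccEquiv k 2 (g k) = Polynomial.C (X 0 * X 1) * Polynomial.X + Polynomial.C (X 0 ^ 2 + X 0 ^ 2 * X 1 ^ 2 + X 1 ^ 2) := by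
    have h1 : finSuccEquiv k 2 (X 1) = Polynomial.C (X 0) := finSuccEquiv_X_succ (j := 0)
    have h2 : finSuccEquiv k 2 (X 2) = Polynomial.C (X 1) := finSuccEquiv_X_succ (j := 1)
    simp only [g, map_add, map_mul, map_pow, finSuccEquiv_X_zero, h1, h2]
    ring
  have hirr : Irreducible (g k) := by
    rw [← MulEquiv.irreducible_iff (finSuccEquiv k 2), hfin]
    exact Polynomial.irreducible_C_mul_X_add_C (mul_ne_zero (X_ne_zero 0) (X_ne_zero 1)) (isRelPrime_coeff k)
  exact UniqueFactorizationMonoid.irreducible_iff_prime.mp hirr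

/-- `(f₁)` is a radical ideal. [folklore] -/
theorem radical_span_f₁ : (Ideal.span {f₁ k}).radical = Ideal.span {f₁ k} :=
  ((Ideal.span_singleton_prime (prime_f₁ k).ne_zero).mpr (prime_f₁ k)).radical

/-- `(g)` is a radical ideal. [folklore] -/
theorem radical_span_g : (Ideal.span {g k}).radical = Ideal.span {g k} :=
  ((Ideal.span_singleton_prime (prime_g k).ne_zero).mpr (prime_g k)).radical

end Steiner

end Summit.ResolutionOfSingularities.ResolutionOfSingularities.Cruxes.EquisingularLiftNat.Sections

end
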